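import Summits.CriticalPhenomena.PercolationContinuityZ3.Theorems.Transplant.SkelFrmQuasiBParamsFaceLamA
import Summits.CriticalPhenomena.PercolationContinuityZ3.Theorems.Transplant.SkelFrmBParamsFaceLamA
import Summits.CriticalPhenomena.PercolationContinuityZ3.Theorems.Transplant.SkelPhiRootBridgeData
import Summits.CriticalPhenomena.PercolationContinuityZ3.Theorems.Transplant.PlanarSkeletonFrmQuasiDefs
import Summits.CriticalPhenomena.PercolationContinuityZ3.Theorems.Transplant.PlanarSkeletonFrmDefs
import Summits.CriticalPhenomena.PercolationContinuityZ3.Theorems.Transplant.SkelPhiStepIDataNS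
import Summits.CriticalPhenomena.PercolationContinuityZ3.Theorems.Transplant.SkelFrmQuasi1ChoiceDefs
import Summits.CriticalPhenomena.PercolationContinuityZ3.Theorems.Transplant.SkelFrmQuasi1ParamsLBL
import Summits.CriticalPhenomena.PercolationContinuityZ3.Theorems.Transplant.SkelFrmQuasi1ParamsPO
import Summits.CriticalPhenomena.PercolationContinuityZ3.Theorems.Transplant.SkelFrmQuasiBChoiceNums
import Summits.CriticalPhenomena.PercolationContinuityZ3.Theorems.Transplant.SkelFrmQuasiBParamsBridgeF
import Summits.CriticalPhenomena.PercolationContinuityZ3.Theorems.Transplant.SkelFrmQuasiBParamsKitS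
import Summits.CriticalPhenomena.PercolationContinuityZ3.Theorems.Transplant.SkelFrmQuasiBParamsLF
import Summits.CriticalPhenomena.PercolationContinuityZ3.Theorems.Transplant.SkelFrmQuasiBParamsSlotsF
import Summits.CriticalPhenomena.PercolationContinuityZ3.Theorems.Transplant.SkelFrmQuasi1SlotTypes
import HarnessLib
import Summits.CriticalPhenomena.PercolationContinuityZ3.Theorems.Transplant.SkelFrmBParamsBridgeFrameF
/-!
# GEN-Q PORT (WAVE-Q table v0.8 section 2, row G130, U-level L16; captain R-6/R-7 2026-08-27: carrier token swap `PlanarSkeletonFrmFrom ↦ PlanarSkeletonFrmQuasi`)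
# of the tree module «Transplant/SkelFrmFromBParamsBridgeFrameF» (sha256 ca2fd381230ae87b…) onto the quasi-step carrier `PlanarSkeletonFrmQuasi` (p507026): «SkelFrmQuasiBParamsBridgeFrameF»

ORIGINAL TITLE: (F) VALUE LAYER, N2 twin (hp-8 g42, 2026-08-23; F-DISCHARGE-MAP-N2 G8/(Δ3)): `port_frm.py` text of N1 `SkelNegBParamsBridgeFrameF` (stmt-g16) over the N2 wide pair

builds on p205010 (kernel theorem, internal audit signed; external expert review pending) — nothing in this file uses p205010; NOTHING is claimed about any open node
((N3-b), the end state).  Lane `prim-bschramm`, seat `prim-hp-8` (gen 62; GEN-Q pen, family BChoiceRoot*/1Root*/BParamsKit·Bridge; tool = captain gen-1 g4's port_genq.py R-14 + p3-g30 T1/T2 + stmt-g33 --force-keep).  Helper file (`--supports stmt-CriticalPhenomena-4575 --as helper`).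
PORT RULES (U-wave r1–r4 re-used, GEN-Q hunk classes of p3-g29 #6136): declaration order, names and proof texts are those of «SkelFrmFromBParamsBridgeFrameF», byte-identical except
(i) the carrier token `PlanarSkeletonFrmFrom ↦ PlanarSkeletonFrmQuasi` in binders, `namespace`/`end` lines and qualified names (module names `SkelFrmFrom… ↦ SkelFrmQuasi…`
in imports of already-ported rows); (ii) `Φ.step ↦ Φ.qstep` with the called Steps lemma replaced by its `…Q`/`_q` twin and the cost `Φ.M` threaded (none in this file unless
listed below); (iii) `Φ.cyl_connected ↦ Φ.cyl_reach` readers (none unless listed); (iv) graph-ball radii / window floors ×`Φ.M` (none unless listed).  HAND HUNK (L-KitS-1 / L-FLOORMAP-1 ⑧): the kit's R′ is read at the window cost of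
record — `KS0.R'0 / KS0.Rlev0 κ Φ t p D mk ↦ KS0.R'0N / KS0.Rlev0N κ Φ (KS.NQ Φ) t p D mk` (stmt-g33's G017 «SkelFrmQuasiBChoiceNums», hp-8's «SkelFrmQuasiBParamsKitSN»).  Carrier-free
residents stay imported/exported from the original «SkelFrmBParamsBridgeFrameF» exactly as in the FrmFrom port.  Docstrings and citations are the original's.

-/

noncomputable section

open scoped Classical

namespace Summit.CriticalPhenomena.PercolationContinuityZ3.Theorems.Transplant

namespace PlanarSkeletonFrmQuasi

namespace NegB

open Literature.Probability.Percolation Literature.Probability.LatticeModels SimpleGraph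
open SkelConc (Consts)
open Skelφ (sgnz sgnz_cases)
open Skelφ.StepI (DataN)
open ChainPlanar (BridgePrm BridgeOK)
open Neg

namespace KS

/-! ## §1 The three face frames and their shared fields -/

section Frames

/-- **The face bridge frame, case `o_b = o_L`** (at the wide pair `(nBF, hBF, ℓBF)`). [this work] -/
def BFs (κ : Consts) {V : Type} [DecidableEq V] [Countable V] {G : SimpleGraph V} [G.LocallyFinite] (Φ : PlanarSkeletonFrmQuasi G) (t : V) (p : unitInterval) (D : Skelφ.StepI.DataNS V) (c : ℕ) (mk : ℕ) (g : ℕ) (f : ℕ) (σ : ℤ) : BridgePrm :=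
  Skelφ.bridgeSame σ (nL κ Φ t p D g f) (hL κ Φ t p D g f) (ℓL κ Φ t p D g f) (KS0.R'0N κ Φ (KS.NQ Φ) t p D mk) (nBF κ Φ t p D c mk) (hBF κ Φ t p D c mk) (ℓBF κ Φ t p D c mk)

/-- **The face bridge frame, case `o_b ≠ o_L`, steep.** [this work] -/
def BFd (κ : Consts) {V : Type} [DecidableEq V] [Countable V] {G : SimpleGraph V} [G.LocallyFinite] (Φ : PlanarSkeletonFrmQuasi G) (t : V) (p : unitInterval) (D : Skelφ.StepI.DataNS V) (c : ℕ) (mk : ℕ) (g : ℕ) (f : ℕ) (σ : ℤ) : BridgePrm :=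
  Skelφ.bridgeTrSide σ (nL κ Φ t p D g f) (hL κ Φ t p D g f) (ℓL κ Φ t p D g f) (KS0.R'0N κ Φ (KS.NQ Φ) t p D mk) (nBF κ Φ t p D c mk) (hBF κ Φ t p D c mk) (ℓBF κ Φ t p D c mk)

/-- **The face bridge frame, case `o_b ≠ o_L`, flat.** [this work] -/
def BFt (κ : Consts) {V : Type} [DecidableEq V] [Countable V] {G : SimpleGraph V} [G.LocallyFinite] (Φ : PlanarSkeletonFrmQuasi G) (t : V) (p : unitInterval) (D : Skelφ.StepI.DataNS V) (c : ℕ) (mk : ℕ) (g : ℕ) (f : ℕ) (σ : ℤ) : BridgePrm :=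
  Skelφ.bridgeTrTop σ (nL κ Φ t p D g f) (hL κ Φ t p D g f) (ℓL κ Φ t p D g f) (KS0.R'0N κ Φ (KS.NQ Φ) t p D mk) (nBF κ Φ t p D c mk) (hBF κ Φ t p D c mk) (ℓBF κ Φ t p D c mk)

-- GEN-Q (R-2, captain 2026-08-27): `PlanarSkeletonFrmFrom.NegB.KS.BF_eq` is not in the used cone of the node top — not ported.

/-- **The three face frames are admissible** (`3 ≤ ℓBF`, `σ = ±1`). [folklore] -/
theorem BF_ok (κ : Consts) {V : Type} [DecidableEq V] [Countable V] {G : SimpleGraph V} [G.LocallyFinite] (Φ : PlanarSkeletonFrmQuasi G) (t : V) (p : unitInterval) (D : Skelφ.StepI.DataNS V) (c : ℕ) (mk : ℕ) (g : ℕ) (f : ℕ) {σ : ℤ} (hσ : σ = 1 ∨ σ = -1) (hℓ : 3 ≤ ℓBF κ Φ t p D c mk) :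
    BridgeOK (BFs κ Φ t p D c mk g f σ) ∧ BridgeOK (BFd κ Φ t p D c mk g f σ) ∧ BridgeOK (BFt κ Φ t p D c mk g f σ) :=
  Skelφ.bridgeOK_all hσ _ _ _ _ _ _ hℓ

/-- **The shared fields**: all three frames have `B₀lo = pt n_L (σh_L)`, `B₀hi = pt n_L (σh_L + ℓ_L)`, `R′ = RA′`, `pr = prBF`. [folklore] -/
theorem BF_shared (κ : Consts) {V : Type} [DecidableEq V] [Countable V] {G : SimpleGraph V} [G.LocallyFinite] (Φ : PlanarSkeletonFrmQuasi G) (t : V) (p : unitInterval) (D : Skelφ.StepI.DataNS V) (c : ℕ) (mk : ℕ) (g : ℕ) (f : ℕ) (σ : ℤ) :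
    ((BFs κ Φ t p D c mk g f σ).B₀lo = Skelφ.pt (nL κ Φ t p D g f : ℤ) (σ * hL κ Φ t p D g f) ∧ (BFd κ Φ t p D c mk g f σ).B₀lo = Skelφ.pt (nL κ Φ t p D g f : ℤ) (σ * hL κ Φ t p D g f) ∧
        (BFt κ Φ t p D c mk g f σ).B₀lo = Skelφ.pt (nL κ Φ t p D g f : ℤ) (σ * hL κ Φ t p D g f)) ∧
      ((BFs κ Φ t p D c mk g f σ).B₀hi = Skelφ.pt (nL κ Φ t p D g f : ℤ) (σ * hL κ Φ t p D g f + ℓL κ Φ t p D g f) ∧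
        (BFd κ Φ t p D c mk g f σ).B₀hi = Skelφ.pt (nL κ Φ t p D g f : ℤ) (σ * hL κ Φ t p D g f + ℓL κ Φ t p D g f) ∧
        (BFt κ Φ t p D c mk g f σ).B₀hi = Skelφ.pt (nL κ Φ t p D g f : ℤ) (σ * hL κ Φ t p D g f + ℓL κ Φ t p D g f)) ∧
      ((BFs κ Φ t p D c mk g f σ).R' = KS0.R'0N κ Φ (KS.NQ Φ) t p D mk ∧ (BFd κ Φ t p D c mk g f σ).R' = KS0.R'0N κ Φ (KS.NQ Φ) t p D mk ∧ (BFt κ Φ t p D c mk g f σ).R' = KS0.R'0N κ Φ (KS.NQ Φ) t p D mk) ∧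
      ((BFs κ Φ t p D c mk g f σ).pr = prBF κ Φ t p D c mk ∧ (BFd κ Φ t p D c mk g f σ).pr = prBF κ Φ t p D c mk ∧ (BFt κ Φ t p D c mk g f σ).pr = prBF κ Φ t p D c mk) :=
  ⟨⟨rfl, rfl, rfl⟩, ⟨rfl, rfl, rfl⟩, ⟨rfl, rfl, rfl⟩, ⟨rfl, rfl, rfl⟩⟩

/-- **`hRl₁`-shape**: `RlevA + 1 ≤ R′` for all three frames (`R′ = RA′ = RlevA + 1`). [folklore] -/
theorem BF_R'_ge (κ : Consts) {V : Type} [DecidableEq V] [Countable V] {G : SimpleGraph V} [G.LocallyFinite] (Φ : PlanarSkeletonFrmQuasi G) (t : V) (p : unitInterval) (D : Skelφ.StepI.DataNS V) (c : ℕ) (mk : ℕ) (g : ℕ) (f : ℕ) (σ : ℤ) :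
    KS0.Rlev0N κ Φ (KS.NQ Φ) t p D mk + 1 ≤ (BFs κ Φ t p D c mk g f σ).R' ∧ KS0.Rlev0N κ Φ (KS.NQ Φ) t p D mk + 1 ≤ (BFd κ Φ t p D c mk g f σ).R' ∧ KS0.Rlev0N κ Φ (KS.NQ Φ) t p D mk + 1 ≤ (BFt κ Φ t p D c mk g f σ).R' := by
  have h := (RA'_eq κ Φ t p D mk).2.1
  refine ⟨?_, ?_, ?_⟩ <;> (show KS0.Rlev0N κ Φ (KS.NQ Φ) t p D mk + 1 ≤ KS0.R'0N κ Φ (KS.NQ Φ) t p D mk; exact le_of_eq rfl)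

/-- **`hB0`** for the face frames: the hop's landing box `[n_L, n_L] × [σh_L, σh_L + ℓ_L]` IS `B₀` (all three frames). [folklore] -/
theorem hB0_F (κ : Consts) {V : Type} [DecidableEq V] [Countable V] {G : SimpleGraph V} [G.LocallyFinite] (Φ : PlanarSkeletonFrmQuasi G) (t : V) (p : unitInterval) (D : Skelφ.StepI.DataNS V) (c : ℕ) (mk : ℕ) (g : ℕ) (f : ℕ) (σ : ℤ) :
    Finset.Icc (Skelφ.pt (nL κ Φ t p D g f : ℤ) (σ * hL κ Φ t p D g f)) (Skelφ.pt (nL κ Φ t p D g f : ℤ) (σ * hL κ Φ t p D g f + ℓL κ Φ t p D g f)) ⊆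
        Finset.Icc (BFs κ Φ t p D c mk g f σ).B₀lo (BFs κ Φ t p D c mk g f σ).B₀hi ∧
      Finset.Icc (Skelφ.pt (nL κ Φ t p D g f : ℤ) (σ * hL κ Φ t p D g f)) (Skelφ.pt (nL κ Φ t p D g f : ℤ) (σ * hL κ Φ t p D g f + ℓL κ Φ t p D g f)) ⊆
        Finset.Icc (BFd κ Φ t p D c mk g f σ).B₀lo (BFd κ Φ t p D c mk g f σ).B₀hi ∧
      Finset.Icc (Skelφ.pt (nL κ Φ t p D g f : ℤ) (σ * hL κ Φ t p D g f)) (Skelφ.pt (nL κ Φ t p D g f : ℤ) (σ * hL κ Φ t p D g f + ℓL κ Φ t p D g f)) ⊆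
        Finset.Icc (BFt κ Φ t p D c mk g f σ).B₀lo (BFt κ Φ t p D c mk g f σ).B₀hi :=
  ⟨fun _ h => h, fun _ h => h, fun _ h => h⟩

/-- **The core-`1` reach budget of the face frames** `YbF := 2·(n_L + |h_L| + ℓ_L + RA′ + S_F + 11)` (`S_F = nBF + ℓBF + |hBF|`). [this work] -/
def YbF (κ : Consts) {V : Type} [DecidableEq V] [Countable V] {G : SimpleGraph V} [G.LocallyFinite] (Φ : PlanarSkeletonFrmQuasi G) (t : V) (p : unitInterval) (D : Skelφ.StepI.DataNS V) (c : ℕ) (mk : ℕ) (g : ℕ) (f : ℕ) : ℕ := 2 * (nL κ Φ t p D g f + (hL κ Φ t p D g f).natAbs + ℓL κ Φ t p D g f + KS0.R'0N κ Φ (KS.NQ Φ) t p D mk + SF κ Φ t p D c mk + 11)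

/-- **`|core1Lo|₁ ≤ YbF`** for the three face frames (`27 ≤ ℓBF`; hp-8's `hπ1` left side). [folklore] -/
theorem core1LoF_l1 (κ : Consts) {V : Type} [DecidableEq V] [Countable V] {G : SimpleGraph V} [G.LocallyFinite] (Φ : PlanarSkeletonFrmQuasi G) (t : V) (p : unitInterval) (D : Skelφ.StepI.DataNS V) (c : ℕ) (mk : ℕ) (g : ℕ) (f : ℕ) {σ : ℤ} (hσ : σ = 1 ∨ σ = -1) (hℓb : 27 ≤ ℓBF κ Φ t p D c mk) :
    ((BFs κ Φ t p D c mk g f σ).core1Lo 0).natAbs + ((BFs κ Φ t p D c mk g f σ).core1Lo 1).natAbs ≤ YbF κ Φ t p D c mk g f ∧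
      ((BFd κ Φ t p D c mk g f σ).core1Lo 0).natAbs + ((BFd κ Φ t p D c mk g f σ).core1Lo 1).natAbs ≤ YbF κ Φ t p D c mk g f ∧
      ((BFt κ Φ t p D c mk g f σ).core1Lo 0).natAbs + ((BFt κ Φ t p D c mk g f σ).core1Lo 1).natAbs ≤ YbF κ Φ t p D c mk g f := by
  have hσ' : |σ| = 1 := by rcases hσ with h | h <;> simp [h]
  have hs : |sgnz (hBF κ Φ t p D c mk)| = 1 := by rcases sgnz_cases (hBF κ Φ t p D c mk) with h | h <;> simp [h]
  have hY : (YbF κ Φ t p D c mk g f : ℤ) = 2 * ((nL κ Φ t p D g f : ℤ) + |hL κ Φ t p D g f| + ℓL κ Φ t p D g f + KS0.R'0N κ Φ (KS.NQ Φ) t p D mk +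
      ((nBF κ Φ t p D c mk : ℤ) + ℓBF κ Φ t p D c mk + |hBF κ Φ t p D c mk|) + 11) := by unfold YbF SF; push_cast [Int.natCast_natAbs]; ring
  have hℓb' : (27 : ℤ) ≤ ℓBF κ Φ t p D c mk := by exact_mod_cast hℓb
  have key : ∀ a b : ℤ, |a| + |b| ≤ (YbF κ Φ t p D c mk g f : ℤ) → a.natAbs + b.natAbs ≤ YbF κ Φ t p D c mk g f := fun a b h => by
    have : ((a.natAbs + b.natAbs : ℕ) : ℤ) ≤ (YbF κ Φ t p D c mk g f : ℤ) := by push_cast [Int.natCast_natAbs]; exact h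
    exact_mod_cast this
  have hσh : |σ * hL κ Φ t p D g f| = |hL κ Φ t p D g f| := by rw [abs_mul, hσ', one_mul]
  have hσb : |σ * hBF κ Φ t p D c mk| = |hBF κ Φ t p D c mk| := by rw [abs_mul, hσ', one_mul]
  have hσs : |σ * sgnz (hBF κ Φ t p D c mk) * nBF κ Φ t p D c mk| = nBF κ Φ t p D c mk := by rw [abs_mul, abs_mul, hσ', hs, one_mul, one_mul, Nat.abs_cast]
  have hRA : (0 : ℤ) ≤ (KS0.R'0N κ Φ (KS.NQ Φ) t p D mk : ℤ) := by positivity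
  have hn : (0 : ℤ) ≤ (nL κ Φ t p D g f : ℤ) := by positivity
  have hnb : (0 : ℤ) ≤ (nBF κ Φ t p D c mk : ℤ) := by positivity
  have hℓL : (0 : ℤ) ≤ (ℓL κ Φ t p D g f : ℤ) := by positivity
  obtain ⟨hh1, hh2⟩ := abs_le.1 (le_of_eq hσh)
  obtain ⟨hb1, hb2⟩ := abs_le.1 (le_of_eq hσb)
  obtain ⟨hs1, hs2⟩ := abs_le.1 (le_of_eq hσs)
  have hha := abs_nonneg (hL κ Φ t p D g f)
  have hba := abs_nonneg (hBF κ Φ t p D c mk)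
  refine ⟨key _ _ ?_, key _ _ ?_, key _ _ ?_⟩
  · unfold BFs ChainPlanar.BridgePrm.core1Lo Skelφ.bridgeSame
    simp only [Pi.add_apply, Pi.sub_apply, Skelφ.pt_zero, Skelφ.pt_one, Pi.natCast_apply]
    rw [hY]
    have ha : |(nL κ Φ t p D g f : ℤ) - (KS0.R'0N κ Φ (KS.NQ Φ) t p D mk : ℕ) + nBF κ Φ t p D c mk| ≤ nL κ Φ t p D g f + KS0.R'0N κ Φ (KS.NQ Φ) t p D mk + nBF κ Φ t p D c mk :=
      abs_le.2 ⟨by linarith, by linarith⟩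
    have hb : |σ * hL κ Φ t p D g f - (KS0.R'0N κ Φ (KS.NQ Φ) t p D mk : ℕ) + σ * hBF κ Φ t p D c mk| ≤ |hL κ Φ t p D g f| + KS0.R'0N κ Φ (KS.NQ Φ) t p D mk + |hBF κ Φ t p D c mk| :=
      abs_le.2 ⟨by linarith, by linarith⟩
    linarith
  · unfold BFd ChainPlanar.BridgePrm.core1Lo Skelφ.bridgeTrSide
    simp only [Pi.add_apply, Pi.sub_apply, Skelφ.pt_zero, Skelφ.pt_one, Pi.natCast_apply]
    rw [hY]
    have ha : |(nL κ Φ t p D g f : ℤ) - (KS0.R'0N κ Φ (KS.NQ Φ) t p D mk : ℕ) + (|hBF κ Φ t p D c mk|)| ≤ nL κ Φ t p D g f + KS0.R'0N κ Φ (KS.NQ Φ) t p D mk + |hBF κ Φ t p D c mk| :=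
      abs_le.2 ⟨by linarith, by linarith⟩
    have hb : |σ * hL κ Φ t p D g f - (KS0.R'0N κ Φ (KS.NQ Φ) t p D mk : ℕ) + σ * sgnz (hBF κ Φ t p D c mk) * nBF κ Φ t p D c mk| ≤ |hL κ Φ t p D g f| + KS0.R'0N κ Φ (KS.NQ Φ) t p D mk + nBF κ Φ t p D c mk :=
      abs_le.2 ⟨by linarith, by linarith⟩
    linarith
  · unfold BFt ChainPlanar.BridgePrm.core1Lo Skelφ.bridgeTrTop
    simp only [Pi.add_apply, Pi.sub_apply, Skelφ.pt_zero, Skelφ.pt_one, Pi.natCast_apply]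
    rw [hY]
    have ha : |(nL κ Φ t p D g f : ℤ) - (KS0.R'0N κ Φ (KS.NQ Φ) t p D mk : ℕ) + ((ℓBF κ Φ t p D c mk : ℤ) - |hBF κ Φ t p D c mk| - 11)| ≤
        nL κ Φ t p D g f + KS0.R'0N κ Φ (KS.NQ Φ) t p D mk + ℓBF κ Φ t p D c mk + |hBF κ Φ t p D c mk| + 11 :=
      abs_le.2 ⟨by linarith, by linarith⟩
    have hb : |σ * hL κ Φ t p D g f - (KS0.R'0N κ Φ (KS.NQ Φ) t p D mk : ℕ) + -(nBF κ Φ t p D c mk : ℤ)| ≤ |hL κ Φ t p D g f| + KS0.R'0N κ Φ (KS.NQ Φ) t p D mk + nBF κ Φ t p D c mk :=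
      abs_le.2 ⟨by linarith, by linarith⟩
    linarith

end Frames

/-! ## §2 The α-clearance `M_u < B₀lo 0 − R′ − pr` at `g := gT mk gx` -/

section AtT

/-- **`hclr₁`** for the face frames at the WIDE pair (all three share the three fields; `KS.hclr₁_F` of part FaceFoot is the root-pair version): `M_u < B₀lo 0 − R′ − pr = n_L − RA′ − prBF` at `g := gT mk gx`, given the face floor
`16·S_F ≤ M_L` (`24M_u + 63 ≤ MBF < nBF ≤ S_F`, `5·eF ≤ M_L < n_L`). [folklore] -/
theorem hclr₁_BF (κ : Consts) {V : Type} [DecidableEq V] [Countable V] {G : SimpleGraph V} [G.LocallyFinite] (Φ : PlanarSkeletonFrmQuasi G) (t : V) (p : unitInterval) (D : Skelφ.StepI.DataNS V) (c : ℕ) (mk : ℕ) (gx : Neg.FSlot) (f : ℕ) (hR0 : 22000 * (KS0.R'0N κ Φ (KS.NQ Φ) t p D mk + 2) ≤ ML κ Φ t p D (gT mk gx κ Φ t p D)) (hSF : 16 * SF κ Φ t p D c mk ≤ ML κ Φ t p D (gT mk gx κ Φ t p D)) (σ : ℤ) :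
    ((Mu D : ℕ) : ℤ) < (BFs κ Φ t p D c mk (gT mk gx κ Φ t p D) f σ).B₀lo 0 - (BFs κ Φ t p D c mk (gT mk gx κ Φ t p D) f σ).R' - (BFs κ Φ t p D c mk (gT mk gx κ Φ t p D) f σ).pr ∧
      ((Mu D : ℕ) : ℤ) < (BFd κ Φ t p D c mk (gT mk gx κ Φ t p D) f σ).B₀lo 0 - (BFd κ Φ t p D c mk (gT mk gx κ Φ t p D) f σ).R' - (BFd κ Φ t p D c mk (gT mk gx κ Φ t p D) f σ).pr ∧
      ((Mu D : ℕ) : ℤ) < (BFt κ Φ t p D c mk (gT mk gx κ Φ t p D) f σ).B₀lo 0 - (BFt κ Φ t p D c mk (gT mk gx κ Φ t p D) f σ).R' - (BFt κ Φ t p D c mk (gT mk gx κ Φ t p D) f σ).pr := by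
  obtain ⟨⟨e1, e2, e3⟩, -, ⟨r1, r2, r3⟩, ⟨q1, q2, q3⟩⟩ := BF_shared κ Φ t p D c mk (gT mk gx κ Φ t p D) f σ
  rw [e1, e2, e3, r1, r2, r3, q1, q2, q3, Skelφ.pt_zero]
  have h1 := five_eF_le_ML κ Φ t p D c mk gx hR0 hSF
  have h2 : ML κ Φ t p D (gT mk gx κ Φ t p D) + 1 ≤ nL κ Φ t p D (gT mk gx κ Φ t p D) f := by
    have := (ML_lt_nL κ Φ t p D (gT mk gx κ Φ t p D) f).1; omega
  have h3 := (MBF_floors κ Φ t p D c mk).2.1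
  have h4 := (RF2F κ Φ t p D c mk).2.1
  have h5 : nBF κ Φ t p D c mk ≤ SF κ Φ t p D c mk := by unfold SF; omega
  have h7 : Mu D + KS0.R'0N κ Φ (KS.NQ Φ) t p D mk + prBF κ Φ t p D c mk < nL κ Φ t p D (gT mk gx κ Φ t p D) f := by unfold eF at h1; omega
  have h8 : ((Mu D + KS0.R'0N κ Φ (KS.NQ Φ) t p D mk + prBF κ Φ t p D c mk : ℕ) : ℤ) < (nL κ Φ t p D (gT mk gx κ Φ t p D) f : ℤ) := by exact_mod_cast h7
  push_cast at h8
  refine ⟨by linarith, by linarith, by linarith⟩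

end AtT

end KS

end NegB

end PlanarSkeletonFrmQuasi

end Summit.CriticalPhenomena.PercolationContinuityZ3.Theorems.Transplant

end
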